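import Mathlib
import Summits.ResolutionOfSingularities.ResolutionOfSingularities.Theorems.RadicialJungCleanModelsContactChainExists
import Literature.AlgebraicGeometry.Resolution.StrictTransformTransverseCurve
import Literature.AlgebraicGeometry.Resolution.CurveConfigurationStrictTransform
import Literature.AlgebraicGeometry.Resolution.PermissibleCentres
import HarnessLib

/-!
# Route `RadicialJung`, crux `CleanModels` (stmt-ResolutionOfSingularities-15917), line `Sketch` rev 35, stub 6 `stub_cleanProp44` (X44c),
# work plan O8 / L7b-global: the strict transform of a regular curve along a chain of point blow-ups has ONE point over the base point

Memo `Cruxes/CleanModels/Lines/Sketch-memo-hand2-g9-stubs-5-7.md` §3a.  Blowing up a closed point `x` (`dim 𝒪_{X,x} = 3`) of a regular curve `C` on a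
locally Noetherian `X`: the schematic strict transform of `C` is `C` itself over `X` (✓ `exists_iso_subscheme_strictTransformIdeal_of_transverse`, Stacks
080E), so the topological strict transform `cl(π⁻¹(C ∖ {x}))` maps INJECTIVELY to `C` (`strictTransform_point_injective`); in particular it has exactly one
point over `x`.  Along a chain `IsPointChainAlong σ C₀ C x n` the only point of `C` over the base point `σ x` is the end point `x`
(`IsPointChainAlong.eq_of_mem_of_eq`).  With ✓ `IsPointChainAlong.cleanPermissibleAt_of_ne` (p816554) and L7b (✓ p816242) this says: after the chain
at a bad closed point, the set of bad closed points of the strict transform is (in bijection with) the old one minus that point.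

Honest framing: OURS (bookkeeping); nothing here proves X44c, resolution in characteristic `p`, or any case of `CleanModels`.
-/

noncomputable section

set_option linter.dupNamespace false -- mandated namespace of this single-conjunct summit

open CategoryTheory AlgebraicGeometry TopologicalSpace IsLocalRing
open Literature.AlgebraicGeometry.Resolution Literature.AlgebraicGeometry.Motives
open Scheme.IdealSheafData

namespace Summit.ResolutionOfSingularities.ResolutionOfSingularities.Theorems.RadicialJung.CleanModels

universe u

/-- **The topological strict transform of a regular curve under the blow-up of one of its closed points maps injectively to the curve.**
[cite: StacksProject, Tag 080E] [cite: CossartPiltant2008, Prop. 4.4 (proof, p. 10)] -/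
theorem strictTransform_point_injective {X X' : Scheme.{u}} [IsLocallyNoetherian X] [IsLocallyNoetherian X'] {π : X' ⟶ X} {x : X}
    {hx : IsClosed ({x} : Set X)} (hπ : IsBlowup π (vanishingIdeal ⟨{x}, hx⟩)) {C : Closeds X}
    (hCreg : ∀ y ∈ (C : Set X), ∃ c : Fin 2 → X.presheaf.stalk y, IsRsopPart c ∧ Ideal.span (Set.range c) = stalkIdeal (vanishingIdeal C) y)
    (hdim : ringKrullDim (X.presheaf.stalk x) = 3) {y₁ y₂ : X'}
    (h₁ : y₁ ∈ closure (π ⁻¹' ((C : Set X) \ {x}))) (h₂ : y₂ ∈ closure (π ⁻¹' ((C : Set X) \ {x}))) (hπy : π y₁ = π y₂) : y₁ = y₂ := by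
  set Y : Closeds X := ⟨{x}, hx⟩ with hY
  have htr : ∀ z ∈ (C : Set X) ∩ Y, stalkIdeal (vanishingIdeal C) z ⊔ stalkIdeal (vanishingIdeal Y) z = maximalIdeal _ := by
    rintro z ⟨hzC, hzY⟩
    have hz : z = x := hzY
    subst hz
    rw [hY, stalkIdeal_vanishingIdeal_singleton hx]
    obtain ⟨c, hc, hcP⟩ := hCreg z hzC
    exact sup_eq_right.mpr (by rw [← hcP]; exact hc.span_range_le_maximalIdeal)
  have hdim' : ∀ z ∈ (C : Set X) ∩ Y, ringKrullDim (X.presheaf.stalk z) = 3 := by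
    rintro z ⟨-, hzY⟩
    have hz : z = x := hzY
    subst hz; exact hdim
  obtain ⟨e, he⟩ := exists_iso_subscheme_strictTransformIdeal_of_transverse hπ hCreg htr hdim'
  have hsupp : ((strictTransformIdeal π (vanishingIdeal Y) (vanishingIdeal C)).support : Set X') = closure (π ⁻¹' ((C : Set X) \ {x})) :=
    CurveConfiguration.coe_support_strictTransformIdeal_vanishingIdeal C
  -- lift the two points to the subscheme
  have hlift : ∀ y ∈ closure (π ⁻¹' ((C : Set X) \ {x})), ∃ c : (strictTransformIdeal π (vanishingIdeal Y) (vanishingIdeal C)).subscheme,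
      (strictTransformIdeal π (vanishingIdeal Y) (vanishingIdeal C)).subschemeι c = y := fun y hy => by
    rw [← Set.mem_range, range_subschemeι, hsupp]; exact hy
  obtain ⟨c₁, hc₁⟩ := hlift y₁ h₁
  obtain ⟨c₂, hc₂⟩ := hlift y₂ h₂
  have himg : ∀ c : (strictTransformIdeal π (vanishingIdeal Y) (vanishingIdeal C)).subscheme,
      (vanishingIdeal C).subschemeι (e.hom c) = π ((strictTransformIdeal π (vanishingIdeal Y) (vanishingIdeal C)).subschemeι c) := fun c => by
    rw [← Scheme.Hom.comp_apply, he, Scheme.Hom.comp_apply]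
  have h12 : (vanishingIdeal C).subschemeι (e.hom c₁) = (vanishingIdeal C).subschemeι (e.hom c₂) := by
    rw [himg, himg, hc₁, hc₂, hπy]
  have hinj : Function.Injective (vanishingIdeal C).subschemeι := (vanishingIdeal C).subschemeι.isClosedEmbedding.injective
  have hc : e.hom c₁ = e.hom c₂ := hinj h12
  have hcc : c₁ = c₂ := by
    have := congrArg e.inv hc
    simpa [← Scheme.Hom.comp_apply] using this
  rw [← hc₁, ← hc₂, hcc]

/-- **Along a chain of point blow-ups following the curve, the end point is the only point of the strict transform over the base point.**
[cite: StacksProject, Tag 080E] -/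
theorem IsPointChainAlong.eq_of_mem_of_eq {X₀ X : Scheme.{u}} {σ : X ⟶ X₀} {C₀ : Closeds X₀} {C : Closeds X} {x : X} {n : ℕ}
    (h : IsPointChainAlong σ C₀ C x n) [IsLocallyNoetherian X₀] [IsLocallyNoetherian X] (hX₀ : Scheme.IsRegular X₀)
    (hC₀reg : ∀ y ∈ (C₀ : Set X₀), ∃ c : Fin 2 → X₀.presheaf.stalk y,
      IsRsopPart c ∧ Ideal.span (Set.range c) = stalkIdeal (vanishingIdeal C₀) y)
    (hxC₀ : σ x ∈ (C₀ : Set X₀)) (hdim₀ : ringKrullDim (X₀.presheaf.stalk (σ x)) = 3) :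
    ∀ y ∈ (C : Set X), σ y = σ x → y = x := by
  induction h with
  | nil C₀ x₀ => intro y _ hy; simpa using hy
  | cons σ C₀ C n τ x' hx hchain hYreg hτ hx' ih =>
    intro y hyC hy
    have hστ : ∀ z, (τ ≫ σ) z = σ (τ z) := fun z => by rw [Scheme.Hom.comp_apply]
    rw [hστ, hστ] at hy
    rw [hστ] at hxC₀ hdim₀
    -- `τ y ∈ C` lies over the base point, hence is the previous point
    have hτyC : τ y ∈ (C : Set _) :=
      (closure_minimal (Set.preimage_mono Set.sdiff_subset) (C.isClosed.preimage τ.continuous)) hyC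
    have hτy : τ y = τ x' := ih hC₀reg hxC₀ hdim₀ (τ y) hτyC hy
    -- uniqueness of the point of the strict transform over `τ x'`
    obtain ⟨hX, hCreg, hxC, hdim⟩ := data_along_pointChain hchain hX₀ hC₀reg hxC₀ hdim₀
    exact strictTransform_point_injective hτ hCreg hdim hyC hx' hτy

end Summit.ResolutionOfSingularities.ResolutionOfSingularities.Theorems.RadicialJung.CleanModels

end
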